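import Summits.BirchSwinnertonDyer.BirchSwinnertonDyer.Cruxes.GordTwoRankZeroOffCaseOne.Lines.three_field_road
import Summits.BirchSwinnertonDyer.BirchSwinnertonDyer.Theorems.ErratumRoadFiveEulerHalfGenusSharpKolyvaginPoints
import Summits.BirchSwinnertonDyer.BirchSwinnertonDyer.Theorems.ErratumRoadFiveEulerHalfGenusSharpKolyvaginCarrier
import Literature.NumberTheory.EllipticCurves.PoitouTateSelmerStructuresConj
import Literature.NumberTheory.EllipticCurves.LevelSelmerLocalConditions
import HarnessLib

/-!
# Line `genus-stringent-road-k` — crux `GordTwoRankZeroOffCaseOne` (item stmt-BirchSwinnertonDyer-19357), route `AdditiveBranchIMC`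

**v3 CANDIDATE — LEAD RESHAPE PROPOSAL (lead `cruxlead-stmt-BirchSwinnertonDyer-19357` g22, 2026-08-31; NOT the registered
skeleton, NOT skeleton-checked; published as `Cruxes/GordTwoRankZeroOffCaseOne/LeadReshapeS5.lean` for the ONE-WRITER of this line
(the crux-plan A lineage) to adopt or amend).** Changes w.r.t. the registered v2 (sha16 7bfcc7fbcc7026bc), everything else
byte-identical: (R1) `StringentPointDatum` gains the TRANSVERSALITY clause (T) «`c_M(P_m) ∈ H¹_tr` at every `λ ∣ ℓ ∣ m`»
(`transverseLocalCondition`), which Jetchev's core-vertex walk (Prop. 6.4) needs and McCallum's order-switch does not give (for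
derivative data it is Howard 2004 Lemma 2.7.3, automatic); (R2) the GLOBAL stub displays its print: `stub_stringentToSharp :
PoitouTatePrint → StringentToSharp` — Jetchev's Thm. 5.1 / Lemma 5.2 (iii) IS the existence half of Poitou–Tate duality for Selmer
structures, in the tree only the named unproved fact `poitouTate_selmerStructure_duality_conj` (every bsd-jet END FORM displays it as
`hPT`); (R3) the cite stub becomes `stub_printedFactsK1 : PrintedFactsK1 := ThreeFieldRoad.PrintedFactsR0 ∧ PoitouTatePrint` (still
7 stubs; S4/S7 keep `ThreeFieldRoad.PrintedFactsR0 →`); the glue `jointUpperBoundAt_kOne` / `genusJointUpperTamFreeR0_of_stubs` and the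
composition are re-threaded (sorry-free). Rationale in full: lead's `LeadReport32.md` §S5 and NOTES; first landed piece of the S5 port:
`Theorems/StringentToSharpWalk.lean` (p830004, `StringentToSharp.exists_coreVertex_of_classFamily`).

crux-plan skeleton (planner `cruxplan-stmt-BirchSwinnertonDyer-19357-genus-stringent-road-k`, 2026-08-31; idea card
`Cruxes/GordTwoRankZeroOffCaseOne/Ideas/genus-stringent-road-k.md`, triage `TRIAGE-r1-1.md` / `TRIAGE-r1-2.md`, both PASS).

HONEST REGISTER. Nothing below the `stub_*` line is proved; the crux is OPEN; BSD is proved for no curve here. This file is a PLAN: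
seven registered stubs and a kernel-checked composition concluding the crux BY NAME. It re-uses, by name, the v48 frame of
`Lines/three_field_road.lean` (sha16 10401f08067c2749): the cite conjunction `ThreeFieldRoad.PrintedFactsR0`, the research residual
`stub_residualR0` (signature verbatim), and the eight sorry-free `_closed` / `_closedT` sub-row theorems. What is NEW is the cut of v48's single
research statement J = `ThreeFieldRoad.GenusJointUpperTamFreeR0` (the Tamagawa-exact genus joint upper half) by the NUMBER k OF RATIONAL
PLACES `v` WITH `p ∣ c_v(Wd)`:

* k = 0 — CLOSED IN-FILE modulo print (`ThreeFieldRowClosed.jointUpperBoundAt_genus`, v47) + the local parity stub G1;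
* k = 1 — CLOSED IN-FILE from three stubs: the LOCAL per-place Néron-component fact for CM points (`stub_perPlaceE0GZ`, [GZ86 III (3.1)] read
  at ONE split place), the J-adapter `stub_genusStringentSupplyK1` (the genus Kolyvagin datum of `(Wd, K″)` rebuilt with STRINGENT modules
  at the unique offending prime `r`, plus the Tamagawa-FULL genus Gross–Zagier valuation identity G2), and the GLOBAL shared statement
  `stub_stringentToSharp : StringentToSharp` (a stringent ring-class-rational Kolyvagin datum at one split-multiplicative prime `r` with
  `p^e ∣ ord_v Δ` is SHARP at depth `e`, i.e. its Kolyvagin classes are killed by `p^{M−e}` — Jetchev's global divisibility read for an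
  ABSTRACT datum; typed ONCE here with generic names, consumed by pen bsd-stepL / item 23444 at `r = p`), composed with the PROVED sharp
  machine `GenusSharpKolyvagin.padicValNat_card_sha_primaryComponent_add_le_of_sharpPoints` and the proved splitting
  `Ш(Wd/K″)[p^∞] = Ш(Wd)[p^∞]·Ш(A)[p^∞]`;
* k ≥ 2 — DECLARED RESIDUAL `stub_residualKTwo` (research; the stringent/Jetchev mechanism caps at `max_v ord_p c_v`, not the sum:
  barrier `Literature.Barriers.BirchSwinnertonDyer.StringentKolyvaginCapsAtMax`).

Composition: `GordTwoRankZeroOffCaseOne_of : S1 → … → S7 → GordTwoRankZeroOffCaseOne` (THE SKELETON THEOREM: hypotheses = the seven stub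
statements under the name-keyed aliases `__Registered.stub_*`; sorry-free, no stub used) and `GordTwoRankZeroOffCaseOne_of_stubs :
GordTwoRankZeroOffCaseOne` (the seven sorried stubs plugged in). Sorries: exactly the seven `stub_*`.
-/

noncomputable section

open scoped Classical Pointwise

-- every file under `Cruxes/GordTwoRankZeroOffCaseOne/` lives in this doubled namespace
set_option linter.dupNamespace false

namespace Summit.BirchSwinnertonDyer.BirchSwinnertonDyer.Cruxes.GordTwoRankZeroOffCaseOne.GenusStringentRoadK

open WeierstrassCurve NumberField IsDedekindDomain Field Function
open Literature.NumberTheory.EllipticCurves Literature.NumberTheory.EllipticCurves.KolyvaginDescent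
open Literature.NumberTheory.GaloisRepresentations
open Literature.NumberTheory.GaloisCohomology
open Summit.BirchSwinnertonDyer.Rank1Residual.X11b
open Summit.BirchSwinnertonDyer.Rank1Residual.X11b.KolyvaginCT
open Summit.BirchSwinnertonDyer.BirchSwinnertonDyer.Theorems.ShimuraKolyvaginOrder
open Summit.BirchSwinnertonDyer.BirchSwinnertonDyer.Theorems.GenusSharpKolyvagin
open Rat.HeightOneSpectrum
  Literature.NumberTheory.EllipticCurves.ModularForms
  Literature.NumberTheory.EllipticCurves.Rank1Residual
  Literature.NumberTheory.EllipticCurves.Rank1Residual.Typed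
  Summit.BirchSwinnertonDyer.Rank1Residual Summit.BirchSwinnertonDyer.Rank1Residual.Additive
  Summit.BirchSwinnertonDyer.BirchSwinnertonDyer.Theses.AdditiveBranchIMC
  Summit.BirchSwinnertonDyer.BirchSwinnertonDyer.Theorems
open ThreeFieldRoadSupply (RamifiedKolyvaginField)

/-! ## §0 Vocabulary (predicates; nothing asserted) -/

/-- `c_v(W)` — the local Tamagawa factor of `W/ℚ` at the finite place `v` of `ℚ`: by definition the `v`-th factor of
`W.tamagawaProduct = ∏ᶠ v, c_v(W)` (`Literature/NumberTheory/EllipticCurves/Tamagawa.lean`). [vocabulary] -/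
def tamagawaAt (W : WeierstrassCurve ℚ) (v : HeightOneSpectrum (𝓞 ℚ)) : ℕ :=
  (W.baseChange (v.adicCompletion ℚ)).localTamagawaNumber (v.adicCompletionIntegers ℚ)

/-- k ≤ 1: at most one finite place `v` of `ℚ` with `p ∣ c_v(W)`. [vocabulary] -/
def AtMostOneTamagawaPlace (W : WeierstrassCurve ℚ) (p : ℕ) : Prop :=
  ∀ v₀ v₁ : HeightOneSpectrum (𝓞 ℚ), p ∣ tamagawaAt W v₀ → p ∣ tamagawaAt W v₁ → v₀ = v₁

/-- k ≥ 2: two distinct finite places `v₀ ≠ v₁` of `ℚ` with `p ∣ c_{v₀}(W)` and `p ∣ c_{v₁}(W)`. [vocabulary] -/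
def TwoTamagawaPlaces (W : WeierstrassCurve ℚ) (p : ℕ) : Prop :=
  ∃ v₀ v₁ : HeightOneSpectrum (𝓞 ℚ), v₀ ≠ v₁ ∧ p ∣ tamagawaAt W v₀ ∧ p ∣ tamagawaAt W v₁

/-- `SharpPointDatum W K p Pt t` — VERBATIM the binder `hpoints` of the PROVED sharp machine
`GenusSharpKolyvagin.padicValNat_card_sha_primaryComponent_add_le_of_sharpPoints` (at `N₀ = N_W`): tower of admissible modules `A m`,
points `P_m` with `P_1 = Pt`, `cPt − εPt` torsion, `τ`-stability, eigen relation, Selmer clause (σ) at every `v ∤ m`, McCallum's 4.4 switch,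
and the divisibility clause (D) `p^{M−t} · c_M(P_m) = 0`. The OUTPUT currency of `StringentToSharp`. [vocabulary; nothing asserted;
cite: McCallumLMS1991 §4 (4)–(6), Cor. 4.5, §5 Cor. 5.6; Jetchev2008 Thm. 1.4, Cor. 1.5; GrossLMS1991 Prop. 6.2] -/
def SharpPointDatum (W : WeierstrassCurve ℚ) [W.IsElliptic] (K : Type) [Field K] [NumberField K] (p : ℕ)
    (Pt : (W.baseChange K).toAffine.Point) (t : ℕ) : Prop :=
  ∀ {M : ℕ} (_hM : 1 ≤ M)
      (hdiv : ∀ Q : geomPoints (W.baseChange K), ∃ R, ((p ^ M : ℕ) : ℤ) • R = Q)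
      (c : K ≃ₐ[ℚ] K) (_hc : c ≠ 1),
      ∃ (ε : ℤ) (τ : AlgebraicClosure K ≃+* AlgebraicClosure K) (hτ : IsLiftOfAut c τ)
        (A : ℕ → AddSubgroup (geomPoints (W.baseChange K)))
        (hA : ∀ m, KolyvaginCocycle.IsAdmissible (Field.absoluteGaloisGroup K) (A m)
          ((p ^ M : ℕ) : ℤ))
        (Pn : ℕ → geomPoints (W.baseChange K))
        (hPn : ∀ m, Pn m ∈
          KolyvaginCocycle.invPoints (Field.absoluteGaloisGroup K) (A m) ((p ^ M : ℕ) : ℤ)),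
        (ε = 1 ∨ ε = -1) ∧
        IsOfFinAddOrder (Affine.Point.map (W' := W) (c : K →ₐ[ℚ] K) Pt - ε • Pt) ∧
        (∀ m, ∀ a ∈ A m, hτ.pointsMap W a ∈ A m) ∧
        Pn 1 = toGeomPoints (W.baseChange K) Pt ∧
        (∀ m : ℕ, Squarefree m →
          (∀ q ∈ m.primeFactors,
            IsKolyvaginPrime (W.conductorNorm ℤ) W K p q ∧ FrobEqFrobInfty W K (p ^ M) q) →
          (∃ B ∈ A m, hτ.pointsMap W (Pn m) =
            (ε * (-1) ^ m.primeFactors.card) • Pn m + ((p ^ M : ℕ) : ℤ) • B) ∧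
          (∀ v : HeightOneSpectrum (𝓞 K), (m : 𝓞 K) ∉ v.asIdeal →
            kolyvaginClass (W.baseChange K) _ hdiv (hA m) (Pn m) (hPn m) ∈
              selmerLocalKer (W.baseChange K) (v.adicCompletion K) ((p ^ M : ℕ) : ℤ)) ∧
          (∀ ℓ : ℕ, ℓ.Prime → ℓ ∣ m → ∀ v : HeightOneSpectrum (𝓞 K), (ℓ : 𝓞 K) ∈ v.asIdeal →
            ∀ a : ℕ, (((p : ℤ) ^ a) •
                kolyvaginClass (W.baseChange K) _ hdiv (hA m) (Pn m) (hPn m) ∈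
                selmerLocalKer (W.baseChange K) (v.adicCompletion K) ((p ^ M : ℕ) : ℤ) ↔
              ((p : ℤ) ^ a) • kolyvaginClass (W.baseChange K) _ hdiv (hA (m / ℓ)) (Pn (m / ℓ))
                  (hPn (m / ℓ)) ∈
                (W.baseChange K).torsionLocalKer (v.adicCompletion K) ((p ^ M : ℕ) : ℤ))) ∧
          ((p : ℤ) ^ (M - t)) • kolyvaginClass (W.baseChange K) _ hdiv (hA m) (Pn m) (hPn m) = 0)

/-- `StringentPointDatum W K ιc p Pt n' r` — a ring-class-rational Kolyvagin datum STRINGENT AT `r`, LEVEL-UNIFORM: the body of pen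
bsd-stepL's `GenusKolyvaginEprimePointsR` (line `genus_S4sharp`, item 23444: sign, lift of complex conjugation, admissible modules `A m`
RATIONAL over an embedded `K[m]`, points `P_m`, `P_1 = Pt`, `cPt − εPt` torsion, eigen relation, McCallum 4.4 switch, and the
Néron-component clause (σ⁰) «`n′ · (A m)_v ⊆ E⁰(K̄_v)`») with FOUR differences [v3: (iv) = clause (T), see R1 in the header]: (i) (σ⁰) is keyed to the places `v ∋ r` of an ARBITRARY
rational prime `r` (23444: `r = p`); (ii) the divisibility clause (D) is ABSENT — (D) is the OUTPUT of `StringentToSharp`, not an input;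
(iii) the modules `A m` and points `P_m` are chosen ONCE, BEFORE the level `p^M` (`∃ A Pn, ∀ M`, not `∀ M, ∃ A Pn`): the level-`M` clauses
(admissibility and `𝒢`-invariance for the divisors of `m`, the eigen relation, the switch) are asked of THE SAME points at every level at
which the prime factors of `m` are Kolyvagin primes — exactly Jetchev's setting (`P_c` fixed, levels `m ≤ M(c)`, [Jetchev2008 §3.1 items 5–7,
p. 817–818]), which his cross-level steps (`κ̃_{c,m}` from `κ_{c,m+m(c)}`; McCallum 1991 Prop. 5.2) require, and which closes the door to
level-dependent "fake" data at small `M`. Heegner-point data are level-uniform by construction, so (iii) costs the supplier nothing. The Selmer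
clause off `r·m` is the separate universal statement `StringentLocalOff`. [vocabulary; nothing asserted; cite: GrossLMS1991 §4, Prop. 6.2 (1),
p. 245; GrossZagier1986 III (3.1); McCallumLMS1991 §4, Prop. 5.2; Jetchev2008 §3.1] -/
def StringentPointDatum (W : WeierstrassCurve ℚ) [W.IsElliptic] (K : Type) [Field K] [NumberField K] (ιc : K →+* ℂ)
    (p : ℕ) (Pt : (W.baseChange K).toAffine.Point) (n' : ℤ) (r : ℕ) : Prop :=
  ∀ (c : K ≃ₐ[ℚ] K) (_hc : c ≠ 1),
    ∃ (ε : ℤ) (τ : AlgebraicClosure K ≃+* AlgebraicClosure K) (hτ : IsLiftOfAut c τ)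
      (A : ℕ → AddSubgroup (geomPoints (W.baseChange K)))
      (emb : ∀ m : ℕ, ringClassField K ιc m →ₐ[K] AlgebraicClosure K)
      (Pn : ℕ → geomPoints (W.baseChange K)),
      (ε = 1 ∨ ε = -1) ∧
      IsOfFinAddOrder (Affine.Point.map (W' := W) (c : K →ₐ[ℚ] K) Pt - ε • Pt) ∧
      (∀ m, ∀ a ∈ A m, hτ.pointsMap W a ∈ A m) ∧
      Pn 1 = toGeomPoints (W.baseChange K) Pt ∧
      (∀ m, m ≠ 0 → ∀ a ∈ A m, ∀ Φ : Field.absoluteGaloisGroup K,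
        (∀ x : ringClassField K ιc m, Φ • emb m x = emb m x) → Φ • a = a) ∧
      (∀ m, ∀ a ∈ A m, ∀ v : HeightOneSpectrum (𝓞 K), ((r : ℕ) : 𝓞 K) ∈ v.asIdeal →
        n' • pointsMap (W.baseChange K) (v.adicCompletion K) a ∈ X11b.E0Receptacle (W.baseChange K) v) ∧
      ∀ {M : ℕ} (_hM : 1 ≤ M)
        (hdiv : ∀ Q : geomPoints (W.baseChange K), ∃ R, ((p ^ M : ℕ) : ℤ) • R = Q)
        (m : ℕ), Squarefree m →
        (∀ q ∈ m.primeFactors,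
          IsKolyvaginPrime (W.conductorNorm ℤ) W K p q ∧ FrobEqFrobInfty W K (p ^ M) q) →
        ∃ (hA : ∀ d, d ∣ m → KolyvaginCocycle.IsAdmissible (Field.absoluteGaloisGroup K) (A d)
            ((p ^ M : ℕ) : ℤ))
          (hPn : ∀ d, d ∣ m → Pn d ∈
            KolyvaginCocycle.invPoints (Field.absoluteGaloisGroup K) (A d) ((p ^ M : ℕ) : ℤ)),
          (∃ B ∈ A m, hτ.pointsMap W (Pn m) =
            (ε * (-1) ^ m.primeFactors.card) • Pn m + ((p ^ M : ℕ) : ℤ) • B) ∧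
          (∀ ℓ : ℕ, ℓ.Prime → (hℓ : ℓ ∣ m) → ∀ v : HeightOneSpectrum (𝓞 K), (ℓ : 𝓞 K) ∈ v.asIdeal →
            ∀ a : ℕ, (((p : ℤ) ^ a) •
                kolyvaginClass (W.baseChange K) _ hdiv (hA m dvd_rfl) (Pn m) (hPn m dvd_rfl) ∈
                selmerLocalKer (W.baseChange K) (v.adicCompletion K) ((p ^ M : ℕ) : ℤ) ↔
              ((p : ℤ) ^ a) • kolyvaginClass (W.baseChange K) _ hdiv
                  (hA (m / ℓ) (Nat.div_dvd_of_dvd hℓ)) (Pn (m / ℓ)) (hPn (m / ℓ) (Nat.div_dvd_of_dvd hℓ)) ∈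
                (W.baseChange K).torsionLocalKer (v.adicCompletion K) ((p ^ M : ℕ) : ℤ))) ∧
          -- (T) [v3, R1] TRANSVERSALITY at the primes of the conductor (Howard 2004 Lemma 2.7.3; Jetchev 2008 §4.2, Prop. 4.7;
          -- W. Zhang 2014 §8.1): the class of `P_m` is inflated from the totally ramified layer `K[ℓ]_λ/K_λ` at every `λ ∣ ℓ ∣ m`
          (∀ ℓ : ℕ, ℓ.Prime → ℓ ∣ m → ∀ v : HeightOneSpectrum (𝓞 K), (ℓ : 𝓞 K) ∈ v.asIdeal →
            kolyvaginClass (W.baseChange K) _ hdiv (hA m dvd_rfl) (Pn m) (hPn m dvd_rfl) ∈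
              transverseLocalCondition W K ιc ((p ^ M : ℕ) : ℤ) ℓ v)

/-- `StringentLocalOff W K ιc p r` — the universal Selmer clause OFF `r·m` for ring-class-rational admissible modules: VERBATIM pen bsd-stepL's
`GenusKolyvaginLocalOffP W p K ιc` (line `genus_S4sharp`; Gross Prop. 6.2 (1) ∕ McCallum Lemma 4.3) with its excluded place `v ∋ p` replaced
by `v ∋ r`. In the k = 1 genus frame it follows from v47's place analysis (`jointUpperBoundAt_genus`, `hloc`) run with the PER-PLACE
hypothesis `p ∤ c_v(Wd)` for `v ∤ r` (see `stub_genusStringentSupplyK1`). [vocabulary; nothing asserted; cite: GrossLMS1991 Prop. 6.2 (1);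
McCallumLMS1991 Lemma 4.3; MilneADT2006 I.3.8] -/
def StringentLocalOff (W : WeierstrassCurve ℚ) [W.IsElliptic] (K : Type) [Field K] [NumberField K] (ιc : K →+* ℂ)
    (p r : ℕ) : Prop :=
  ∀ {m : ℕ} (_hm : m ≠ 0) (e : ringClassField K ιc m →ₐ[K] AlgebraicClosure K)
    (_hKol : ∀ q ∈ m.primeFactors, IsKolyvaginPrime (W.conductorNorm ℤ) W K p q)
    {M : ℕ} {hdiv : ∀ P : geomPoints (W.baseChange K), ∃ Q, ((p ^ M : ℕ) : ℤ) • Q = P}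
    {A : AddSubgroup (geomPoints (W.baseChange K))}
    (hA : KolyvaginCocycle.IsAdmissible (Field.absoluteGaloisGroup K) A ((p ^ M : ℕ) : ℤ))
    (_hArat : ∀ a ∈ A, ∀ Φ : Field.absoluteGaloisGroup K,
      (∀ x : ringClassField K ιc m, Φ • e x = e x) → Φ • a = a)
    {P : geomPoints (W.baseChange K)}
    (hP : P ∈ KolyvaginCocycle.invPoints (Field.absoluteGaloisGroup K) A ((p ^ M : ℕ) : ℤ))
    (v : HeightOneSpectrum (𝓞 K)) (_hv : ((m : ℕ) : 𝓞 K) ∉ v.asIdeal) (_hvr : ((r : ℕ) : 𝓞 K) ∉ v.asIdeal),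
    kolyvaginClass (W.baseChange K) ((p ^ M : ℕ) : ℤ) hdiv hA P hP ∈
      selmerLocalKer (W.baseChange K) (v.adicCompletion K) ((p ^ M : ℕ) : ℤ)

/-- **`StringentToSharp` — THE SHARED GLOBAL STATEMENT (typed ONCE, generic names; director-bsd (840)(i)).** For `W/ℚ` elliptic, `K` imaginary
quadratic with a complex embedding `ιc`, a prime `p ≥ 5` with `ρ̄_{W,p}` onto, a rational prime `r` SPLIT in `K` at whose places `W ⊗ K` is
SPLIT MULTIPLICATIVE with `p^e ∣ ord_v Δ_min` (so `p^e ∣ c_v = c_r(W)`), a non-torsion `Pt ∈ W(K)` of finite index, an integer `n′` prime to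
`p`: a ring-class-rational Kolyvagin datum through `Pt` that is STRINGENT at `r` (`StringentPointDatum`: `n′·(A m)_v ⊆ E⁰(K̄_v)` at `v ∋ r`)
and Selmer off `r·m` (`StringentLocalOff`) IS SHARP AT DEPTH `e` (`SharpPointDatum … Pt e`: the SAME kind of datum with the Selmer clause at every
`v ∤ m` and the divisibility (D) `p^{M−e}·c_M(P_m) = 0`). Mathematics: the Selmer clause at `v ∋ r` is the PROVED carrier lemma
`kolyvaginClass_mem_selmerLocalKer_of_ringClassRational_of_zsmul_mem_E0Receptacle`; the content is (D) — Jetchev's GLOBAL DIVISIBILITY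
`m(c) ≥ m_max` for every Kolyvagin conductor `c` (Jetchev 2008 Thm. 1.4 `m_∞ ≥ m_max` with `m_∞ = inf_c m(c)`, §3.1 item 5, held text
`paper:arxiv-math_0703431` p. 813 ∕ p. 817), proved there for THE Heegner system under Hypothesis (∗) (`p ∤ N`, `ρ̄` onto) and the Heegner
hypothesis, by: Prop. 4.9 (the classes lie in the STRINGENT Kummer structure `𝓕_⌈q⌉`, Def. 4.8 — from `P_c − Q ∈ E⁰(K_v^ur)`, i.e. exactly
the input (σ⁰)), Poitou–Tate Thm. 5.1, the lozenge Lemma 5.2, Čebotarev Lemma 6.1 (= McCallum Cor. 3.2), core vertices Thm. 6.3 ∕ Prop. 6.4,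
and the local quotient `H¹_Kum/H¹_{Kum⁰} ≅ ℤ/p^{m_max}` at `v, v̄ ∣ q` (`c_v = c_{v̄} = c_q`, `q` SPLIT). The §§5–6 half is CARRIER-BLIND finite-module
bookkeeping and is ALREADY KERNEL-PROVED in the tree over abstract Selmer-module data (cell bsd-jet: `Rank1ResidualJetSection6`
`tamagawaExponent_le_mInfty_of_coreVertices`, `depth_le_mdiv_of_coreVertices`; `Rank1ResidualJetCebotarevAdapter`;
`Rank1ResidualJetSignedDualityRelaxed` ∕ `…RowDualityCarrier`; `JET.McCallumProp44ByName`; `JET.RingClassTransverse{Local,Lagrangian,SelfDual,Count}`),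
so the prover's work is the INSTANTIATION layer (Selmer structures `𝓕(c)`, `𝓕_⌈r⌉(c)`, `(𝓕₀)^ℓ(c)` on `H¹(K, E[p^M])^±` from the datum's
classes; Prop. 6.4's invariant-lowering induction; McCallum Prop. 5.2) for an ABSTRACT LEVEL-UNIFORM stringent datum (any `N`, any `D_K`,
one split `r`) — the same stub set as bsd-jet's (J∥) kernel line (sheet `PV2-J6-KERNEL.md`), typed here once over the datum rather than over
Heegner points. Consumers: this file at `(W, r, e) = (Wd, r, ord_p ∏c(Wd))` (k = 1) and pen bsd-stepL ∕ item 23444 at `r = p`, `e = ord_p c_p(W)`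
(there Prop. 4.9 at `v ∣ p` is the x11b3 theorem `X11b.Three.JetchevKummer.localKummerMap_mem_connectedKummerCondition_padic_of_cocycle`).
WHY IT MIGHT FAIL: for an ABSTRACT datum the Čebotarev primes of Lemma 6.1 ∕ Prop. 6.4 must be found INSIDE the datum's index set `Λ_M`
(Kolyvagin primes with `FrobEqFrobInfty` at level `p^M`) with prescribed localisations of classes of lower level, and the transverse condition
at `λ ∣ c` must be read off the McCallum switch clause alone; at `p ∣ D_K`, `p² ∣ N` (the k = 1 genus frame) none of this is in print.
[L; GLOBAL; research-adjacent; cite: Jetchev2008 Def. 4.8, Prop. 4.9, Thm. 5.1, Lemma 5.2, Lemma 6.1, Thm. 6.3, Prop. 6.4, Thm. 1.4, Cor. 1.5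
(pp. 813, 820–825); GrossLMS1991 Prop. 6.2; McCallumLMS1991 Cor. 3.2, Cor. 4.5, Prop. 5.2] -/
def StringentToSharp : Prop :=
  ∀ (W : WeierstrassCurve ℚ) [W.IsElliptic] (K : Type) [Field K] [NumberField K] (ιc : K →+* ℂ) (p r e : ℕ) [Fact p.Prime]
    (Pt : (W.baseChange K).toAffine.Point) (n' : ℤ),
    IsImaginaryQuadratic K → 5 ≤ p → W.HasSurjectiveModNGaloisRep p → ¬ IsOfFinAddOrder Pt →
    (AddSubgroup.zmultiples Pt).index ≠ 0 → r.Prime →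
    ((Ideal.span {((r : ℕ) : ℤ)}).primesOver (𝓞 K)).ncard = 2 →
    (∀ v : HeightOneSpectrum (𝓞 K), ((r : ℕ) : 𝓞 K) ∈ v.asIdeal →
      (W.baseChange K).HasSplitMultiplicativeReductionAt v ∧ p ^ e ∣ (W.baseChange K).ordMinimalDiscriminant v) →
    IsCoprime (p : ℤ) n' → StringentLocalOff W K ιc p r → StringentPointDatum W K ιc p Pt n' r →
    SharpPointDatum W K p Pt e

/-- **`PerPlaceE0GZ` — THE LOCAL STATEMENT: CM points of conductor `m` land in `E⁰` up to rational torsion at every place over a prime `r ∥ N`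
SPLIT in `K`** ([GZ86 III (3.1)] ∕ Gross 1991 p. 245 «the points `y_n` lie in a subgroup `E′` whose image in `Φ` has order prime to `p`», read
PER PLACE under the generalized Heegner condition `4N ∣ β² − D_K` — in print only under `(D_K, N) = 1`, but the proof is local at `r`: a CM
point by `𝒪_m`, `r ∤ m`, has ordinary good reduction at `w ∣ r` and meets the component of the cusp `∞` or of the cusp `0` of `X₀(N)_{𝔽_r}`
(`r ∥ N`, Deligne–Rapoport), so `(x) − (cusp)` lies in `J₀(N)⁰` and its image differs from `y` by `φ((0) − (∞)) ∈ E(ℚ)_tors` (Manin–Drinfeld);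
`n′ := #E(ℚ)_tors` kills the difference; Néron functoriality of `φ_*`). Typed for every `K`-embedding `e : K[m] → K̄` (so all conjugates and all
places `w ∣ v` are covered) against the tree's receptacle `X11b.E0Receptacle`. WHY IT MIGHT FAIL: only as a typing — the tree's `E0Receptacle (E⊗K) v`
over `K̄_v` vs. the Néron model over ramified extensions of `K_v` (CM points are unramified at `r ∤ m`, so no issue is expected); `ModularParametrizationData`'s
normalisation of `φ(∞)`. [M; LOCAL; print-adjacent; cite: GrossZagier1986 III (3.1); GrossLMS1991 p. 245; DeligneRapoport1973 VI.6; Manin1972 (Manin–Drinfeld)] -/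
def PerPlaceE0GZ : Prop :=
  ∀ (E' : WeierstrassCurve ℚ) [E'.IsElliptic] (N : ℕ) [NeZero N] (K : Type) [Field K] [NumberField K],
    IsImaginaryQuadratic K →
    ∀ (Dt : ModularParametrizationData E' N) (β : ℤ) (ι : K →+* ℂ) (m : ℕ),
    (4 * (N : ℤ)) ∣ β ^ 2 - NumberField.discr K → m ≠ 0 → Nat.Coprime m N →
    ∀ (y : (E'.baseChange (ringClassField K ι m)).toAffine.Point),
    Affine.Point.map (ringClassField K ι m).subtype.toRatAlgHom y = heegnerPointComplexOfConductor Dt (NumberField.discr K) β m →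
    ∀ (e : ringClassField K ι m →ₐ[K] AlgebraicClosure K) (r : ℕ), r.Prime → r ∣ N → ¬ r ^ 2 ∣ N →
    ¬ (r : ℤ) ∣ NumberField.discr K →
    ∀ v : HeightOneSpectrum (𝓞 K), ((r : ℕ) : 𝓞 K) ∈ v.asIdeal →
      (E'.torsionOrder : ℤ) • pointsMap (E'.baseChange K) (v.adicCompletion K)
          (Affine.Point.map (W' := E') e.toRingHom.toRatAlgHom y) ∈
        X11b.E0Receptacle (E'.baseChange K) v

/-- **`GenusStringentSupplyK1` — THE J-ADAPTER ON THE k = 1 ROWS** (J's binders verbatim + `p ∣ ∏c(Wd)` + `AtMostOneTamagawaPlace Wd p`): there are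
a complex embedding `ιc` of `K″`, THE offending prime `r` (the unique place with `p ∣ c_r(Wd)`; `r` split multiplicative for `Wd`, split in `K″`
by `RamifiedKolyvaginField`, `p^e ∥ c_r(Wd) = ord_r Δ = ord_v Δ(Wd ⊗ K″)` with `e := ord_p ∏c(Wd)`), a non-torsion `Pt ∈ Wd(K″)` of finite index
(the genus-transported Heegner point, v47 U-a), an integer `n′` prime to `p`, such that: (G2) the genus Gross–Zagier valuation identity WITH ITS
TAMAGAWA TERMS `ord_p(L-values) + ord_p ∏c(Wd) + ord_p ∏c(A) = 2·ord_p [Wd(K″) : ℤPt]` (v47's `exists_genusHeegnerData_not_isOfFinAddOrder_padicValRat`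
redone WITHOUT dropping the Tamagawa terms — CST Thm 1.1 + the tree's BSD-invariant bookkeeping); the universal off-`r` Selmer clause
`StringentLocalOff` (v47's `hloc` with the per-place nonsplit lemma: `p ∤ c_v(Wd)` for `v ∤ r`); and a `StringentPointDatum` through `Pt` at `r`
(v47's `genusKolyvaginPointsR_of_facts` ∕ bsd-stepL K4e REBUILT with span modules generated by the transported CM points and `Wd(ℚ)`-torsion, so
that (σ⁰) at `v ∋ r` follows from `PerPlaceE0GZ` on generators, transported along the `K[1]`-isomorphism `Θ : E′ ≅ Wd`, unramified at `r`).
Conditional on print (`PrintedFactsR0`) and on the LOCAL statement (`PerPlaceE0GZ`). WHY IT MIGHT FAIL: engineering only — the modules of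
K4e are existential outputs; the rebuild must re-verify admissibility/rationality for the explicit spans. [L (M engineering ×3: G2, off-`r` hloc,
span rebuild); cite: CaiShuTian2014 Thm 1.1; GrossLMS1991 §§3–5; McCallumLMS1991 §4; Voight2007 Prop 3.8] -/
def GenusStringentSupplyK1 : Prop :=
  ∀ (Wd : WeierstrassCurve ℚ) [Wd.IsElliptic] [Wd.IsGloballyMinimal] (A : WeierstrassCurve ℚ) [A.IsElliptic]
    [A.IsGloballyMinimal] (p : ℕ) [Fact p.Prime] (K'' : Type) [Field K''] [NumberField K''],
    5 ≤ p → Wd.analyticRank = 1 → A.analyticRank = 0 → N10.CellGordTwo Wd p → Surj Wd p →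
    RamifiedKolyvaginField Wd A p K'' →
    (∃ ℓ : ℕ, ℓ.Prime ∧ (ℓ : ℤ) ∣ NumberField.discr K'' ∧ ℓ ≠ p ∧ ¬ ℓ ∣ Wd.conductorNorm ℤ) →
    (∃ C : VariableChange ℚ, C • Wd.quadraticTwist (NumberField.discr K'' : ℚ) = A) → GoodOrd A p →
    p ∣ Wd.tamagawaProduct → AtMostOneTamagawaPlace Wd p →
    ∃ (ιc : K'' →+* ℂ) (r : ℕ) (_ : r.Prime) (Pt : (Wd.baseChange K'').toAffine.Point) (n' : ℤ),
      ¬ IsOfFinAddOrder Pt ∧ (AddSubgroup.zmultiples Pt).index ≠ 0 ∧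
      ((Ideal.span {((r : ℕ) : ℤ)}).primesOver (𝓞 K'')).ncard = 2 ∧
      (∀ v : HeightOneSpectrum (𝓞 K''), ((r : ℕ) : 𝓞 K'') ∈ v.asIdeal →
        (Wd.baseChange K'').HasSplitMultiplicativeReductionAt v ∧
          p ^ padicValNat p Wd.tamagawaProduct ∣ (Wd.baseChange K'').ordMinimalDiscriminant v) ∧
      IsCoprime (p : ℤ) n' ∧
      (∃ q qA : ℚ, shaAn Wd = q ∧ shaAn A = qA ∧
        padicValRat p q + padicValRat p qA + padicValNat p Wd.tamagawaProduct + padicValNat p A.tamagawaProduct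
          = 2 * padicValNat p (AddSubgroup.zmultiples Pt).index) ∧
      StringentLocalOff Wd K'' ιc p r ∧ StringentPointDatum Wd K'' ιc p Pt n' r

/-- **`TamagawaParityR0` — G1, LOCAL PARITY `ord_p ∏c(A) = ord_p ∏c(Wd)`** on J's binders (`A ≅ Wd ⊗ χ_{D_{K″}}`): at `ℓ ∣ N_{Wd}`, `ℓ ∤ D_{K″}`
the prime `ℓ` splits in `K″` (`RamifiedKolyvaginField`), so `D_{K″}` is a square in `ℚ_ℓ` and `c_ℓ(A) = c_ℓ(Wd)`; at `ℓ ∣ D_{K″}` one of the two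
curves is additive or non-split (`c_ℓ ≤ 4 < p`, resp. `c_ℓ ∣ 2`) and so is the other (`RamifiedKolyvaginField` field 4, `GoodOrd A p`,
`CellGordTwo Wd p`); elsewhere both are good. WHY IT MIGHT FAIL: only through the tree's junk values of `localTamagawaNumber` at places of `ℚ`
(no `IsAdicComplete` instance for `v.adicCompletionIntegers ℚ` — route through `ℤ_[ℓ]` as `Tamagawa.lean` does). The CHEAPEST FALSIFIER of the
line (triage seat 2, F1): land it first. [S–M; LOCAL; cite: SilvermanAEC2009 VII.6, App. C.16; Connell1994 (twist Tamagawa numbers); tree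
`localTamagawaNumber_variableChange`, `localTamagawaNumber_eq_ordMinimalDiscriminant_of_hasSplitMultiplicativeReductionAt`] -/
def TamagawaParityR0 : Prop :=
  ∀ (Wd : WeierstrassCurve ℚ) [Wd.IsElliptic] [Wd.IsGloballyMinimal] (A : WeierstrassCurve ℚ) [A.IsElliptic]
    [A.IsGloballyMinimal] (p : ℕ) [Fact p.Prime] (K'' : Type) [Field K''] [NumberField K''],
    5 ≤ p → N10.CellGordTwo Wd p → RamifiedKolyvaginField Wd A p K'' →
    (∃ C : VariableChange ℚ, C • Wd.quadraticTwist (NumberField.discr K'' : ℚ) = A) → GoodOrd A p →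
    padicValNat p A.tamagawaProduct = padicValNat p Wd.tamagawaProduct

/-- **`GenusJointUpperKTwoR0` — THE DECLARED RESIDUAL, k ≥ 2**: J = `ThreeFieldRoad.GenusJointUpperTamFreeR0` restricted to the rows with TWO
distinct places `v₀ ≠ v₁` of `ℚ` with `p ∣ c_{v₀}(Wd)`, `p ∣ c_{v₁}(Wd)`. NOT reachable by this line's mechanism: a stringent datum at several
primes yields (D) only at depth `max_v ord_p c_v(Wd)` (Jetchev 2008 Thm 1.4 is stated with `max`, and the Čebotarev choice of Kolyvagin primes
cannot see two component groups at once) — barrier `Literature.Barriers.BirchSwinnertonDyer.StringentKolyvaginCapsAtMax`; what would close it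
is W. Zhang's refined Kolyvagin conjecture `𝓜_∞ = Σ_v ord_p c_v` for the genus system (print: JSW 2017 Thm 3.3.1 ∕ BCGS 2023, good ordinary `p`
split — not our `p ∣ D_{K″}`). RESEARCH; TRUE iff BSD_p for `Wd` and `A` on these rows. [XL; research; NOT benchable;
cite: Jetchev2008 Thm 1.4; WZhang2014 Thm 1.1 / Conj. (Kolyvagin); JetchevSkinnerWan2017 Thm 3.3.1] -/
def GenusJointUpperKTwoR0 : Prop :=
  ∀ (Wd : WeierstrassCurve ℚ) [Wd.IsElliptic] [Wd.IsGloballyMinimal] (A : WeierstrassCurve ℚ) [A.IsElliptic]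
    [A.IsGloballyMinimal] (p : ℕ) [Fact p.Prime] (K'' : Type) [Field K''] [NumberField K''],
    5 ≤ p → Wd.analyticRank = 1 → A.analyticRank = 0 → N10.CellGordTwo Wd p → Surj Wd p →
    RamifiedKolyvaginField Wd A p K'' →
    (∃ ℓ : ℕ, ℓ.Prime ∧ (ℓ : ℤ) ∣ NumberField.discr K'' ∧ ℓ ≠ p ∧ ¬ ℓ ∣ Wd.conductorNorm ℤ) →
    (∃ C : VariableChange ℚ, C • Wd.quadraticTwist (NumberField.discr K'' : ℚ) = A) → GoodOrd A p →
    TwoTamagawaPlaces Wd p →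
    SchneiderFree.Upper.JointUpperBoundAt Wd A p

/-- The statement of `stub_residualR0` (v48's signature VERBATIM, named so that the composition can take it as a hypothesis). [vocabulary] -/
def ResidualR0 : Prop :=
  ∀ (W : WeierstrassCurve ℚ) [W.IsElliptic] [W.IsGloballyMinimal] (p : ℕ) [Fact p.Prime],
    W.analyticRank = 0 → N10.CellGordTwo W p → ¬ HasCaseOneMember W p →
      ¬ ThreeFieldRoad.TwistRowT W p → ¬ ThreeFieldRoad.DyadicWanRowR0T W p →
        ¬ ThreeFieldRoad.TwistedWanRowR0LooseUnitCutT W p → ¬ ThreeFieldRoad.TwistedWanRowR0TwoT W p →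
          MissingLowerBoundAt W p

/-- [v3, R2] **Poitou–Tate duality for Selmer structures (conjugation-compatible form) at every number field** — the print
that Jetchev's Thm. 5.1 / Lemma 5.2 (iii) IS; the tree's named fact BY NAME (cite-only; reduced in the tree to Milne I Thm. 2.6 +
Thm. 4.10(b) `⊇` for the canonical invariant maps, `poitouTate_selmerStructure_duality_conj_of_canonical_numberField`; the
reciprocity direction is proved). [vocabulary; nothing asserted; cite: MilneADT2006 I Thm. 4.10(b); Howard2004HeegnerKolyvagin
Thm. 2.1.11; Jetchev2008 Thm. 5.1] -/
def PoitouTatePrint : Prop :=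
  ∀ (K : Type) [Field K] [NumberField K], poitouTate_selmerStructure_duality_conj K

/-- [v3, R3] The cite conjunction of THIS line: v48's `ThreeFieldRoad.PrintedFactsR0` (20 Literature names) AND `PoitouTatePrint`.
[CITE-ONLY vocabulary; nothing asserted] -/
def PrintedFactsK1 : Prop :=
  ThreeFieldRoad.PrintedFactsR0 ∧ PoitouTatePrint

/-! ## §1 The registered stubs (the ONLY sorries of this file) -/

/-- stub S1 (residualR0) — v48's research residual, signature VERBATIM (`ThreeFieldRoad.stub_residualR0`): the rows on none of the eight closed /
J-closed sub-rows (`p = 3`; `ρ̄` not onto; an additive prime of non-twist type; no (twisted ∕ dyadic) Wan prime). SHARED with line `three_field_road`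
(same statement; one proof closes both). [XL, open-problem, research by design; NOT benchable] -/
theorem stub_residualR0 : ResidualR0 := by
  sorry

/-- stub S2 (printedFactsK1) [v3, R3] — the cite conjunction `PrintedFactsK1` = line `three_field_road`'s `ThreeFieldRoad.PrintedFactsR0`
(20 sorry-free Literature `def … : Prop` names) ∧ `PoitouTatePrint`. [CITE-ONLY — never a proof target, never benched] -/
theorem stub_printedFactsK1 : PrintedFactsK1 := by
  sorry

/-- stub S3 (perPlaceE0GZ) — THE LOCAL STATEMENT `PerPlaceE0GZ` ([GZ86 III (3.1)] per place; see its docstring). [M; LOCAL; print-adjacent;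
cite: GrossZagier1986 III (3.1); GrossLMS1991 p. 245] -/
theorem stub_perPlaceE0GZ : PerPlaceE0GZ := by
  sorry

/-- stub S4 (genusStringentSupplyK1) — THE J-ADAPTER on the k = 1 rows, conditional on print and on the local statement: from `PrintedFactsR0` and
`PerPlaceE0GZ`, the stringent genus datum supply `GenusStringentSupplyK1` (see its docstring: offending prime `r`, G2 with Tamagawa terms,
off-`r` Selmer clause, stringent datum through the genus Heegner point). [L = 3 × M engineering; cite: CaiShuTian2014 Thm 1.1; GrossLMS1991 §§3–6;
McCallumLMS1991 §4; Voight2007 Prop 3.8] -/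
theorem stub_genusStringentSupplyK1 : ThreeFieldRoad.PrintedFactsR0 → PerPlaceE0GZ → GenusStringentSupplyK1 := by
  sorry

/-- stub S5 (stringentToSharp) — THE SHARED GLOBAL STATEMENT `StringentToSharp` (see its docstring); the HARDEST stub of the line; consumed by name by
pen bsd-stepL ∕ item 23444 at `r = p`. [v3, R2: displays `PoitouTatePrint`; its datum carries (T), R1.] It is the stub that CARRIES the non-division-invariant clause: input (σ⁰) (`StringentPointDatum`), output (D)
(`SharpPointDatum`) — the currency lesson of `TRIAGE-r1-2.md` §B. [L; GLOBAL; research-adjacent; cite: Jetchev2008 Thm 1.4, (1), Cor 1.5;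
GrossLMS1991 Prop 6.2; McCallumLMS1991 Cor 4.5, Prop 5.2] -/
theorem stub_stringentToSharp : PoitouTatePrint → StringentToSharp := by
  sorry

/-- stub S6 (tamagawaParityR0) — G1, the local Tamagawa parity `TamagawaParityR0`; cheapest falsifier of the line, to be landed FIRST. [S–M; LOCAL;
cite: SilvermanAEC2009 VII.6; tree `Tamagawa.lean`] -/
theorem stub_tamagawaParityR0 : TamagawaParityR0 := by
  sorry

/-- stub S7 (residualKTwo) — THE DECLARED RESIDUAL k ≥ 2 (`GenusJointUpperKTwoR0`), conditional on print like v48's J; research, barrier-blocked for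
this line's mechanism (`StringentKolyvaginCapsAtMax`). [XL; research; NOT benchable] -/
theorem stub_residualKTwo : ThreeFieldRoad.PrintedFactsR0 → GenusJointUpperKTwoR0 := by
  sorry

/-! ## §2 Proved glue (sorry-free): k = 0 and k = 1 close J on their rows; the k-trichotomy gives J -/

/-- The nine derived facts of v47's `jointUpperBoundAt_genus`, read off `PrintedFactsR0` (conjuncts 1, 2, 3, 5, 6, 9, 10) exactly as
`TwistRowClosedKolyvagin.missingLowerBoundAt_rankZero_of_twistAny_twelveFacts_kolyvagin` does; k = 0 (`p ∤ ∏c(Wd)`, hence `p ∤ ∏c(A)` by G1) is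
v47's theorem. -/
theorem jointUpperBoundAt_kZero (hPF : ThreeFieldRoad.PrintedFactsR0) (hPar : TamagawaParityR0)
    (Wd : WeierstrassCurve ℚ) [Wd.IsElliptic] [Wd.IsGloballyMinimal]
    (A : WeierstrassCurve ℚ) [A.IsElliptic] [A.IsGloballyMinimal] (p : ℕ) [Fact p.Prime]
    (K'' : Type) [Field K''] [NumberField K'']
    (h5 : 5 ≤ p) (hrd : Wd.analyticRank = 1) (hrA : A.analyticRank = 0) (hcell : N10.CellGordTwo Wd p) (hsurj : Surj Wd p)
    (hK'' : RamifiedKolyvaginField Wd A p K'')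
    (hfree : ∃ ℓ : ℕ, ℓ.Prime ∧ (ℓ : ℤ) ∣ NumberField.discr K'' ∧ ℓ ≠ p ∧ ¬ ℓ ∣ Wd.conductorNorm ℤ)
    (htwA : ∃ C : WeierstrassCurve.VariableChange ℚ, C • Wd.quadraticTwist (NumberField.discr K'' : ℚ) = A)
    (hgo : GoodOrd A p) (htamd : ¬ p ∣ Wd.tamagawaProduct) :
    SchneiderFree.Upper.JointUpperBoundAt Wd A p := by
  have hp : p.Prime := Fact.out
  obtain ⟨fB, fK, f6, -, f10, fMaz, -, -, f16, fES, -, -, -, -, -, -, -, -, -, -⟩ := hPF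
  have hnf : exists_isNewformOf := exists_isNewformOf_of_nonempty_modularParametrizationData f6
  have hmod : hasEntireLFunction_rat := WeierstrassCurve.hasEntireLFunction_rat_of_exists_isNewformOf hnf
  have hGZK : rank_eq_analyticRank_of_analyticRank_le_one :=
    ExplicitGrossZagierTrivialChar.rank_eq_analyticRank_of_analyticRank_le_one_of_kolyvagin f6 f16 fB f10 fK
  have hNek : Nekovar2007.cmPoint_frobeniusCongruence := Nekovar2007.cmPoint_frobeniusCongruence_of_eichlerShimuraRelation fES
  have hGZ73 : GrossZagier1986_thm_I_7_3 :=
    ExplicitGrossZagierTrivialChar.GrossZagier1986_thm_I_7_3_of_thm11_ringClassChar f6 f16 f10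
  have hG1 : ∀ (N : ℕ) [NeZero N] (W : WeierstrassCurve ℚ) (K : Type) [Field K] [NumberField K],
      phi_heegnerPointOfConductor_mem_range_map_ringClassField_birch N W K :=
    forall_phi_heegnerPointOfConductor_mem_range_map_ringClassField_birch
  have hP53 : ∀ (N : ℕ) [NeZero N] (W : WeierstrassCurve ℚ) (K : Type) [Field K] [NumberField K],
      GrossLMS1991.prop53_conj_pinned_birch N W K :=
    fun N _ W' K _ _ ↦ GrossLMS1991.prop53_conj_pinned_birch_of_exists_isNewformOf hnf N W' K
  -- G1: `ord_p ∏c(A) = ord_p ∏c(Wd) = 0`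
  have htamA : ¬ p ∣ A.tamagawaProduct := by
    have h0 : padicValNat p Wd.tamagawaProduct = 0 := padicValNat.eq_zero_of_not_dvd htamd
    have hG1' := hPar Wd A p K'' h5 hcell hK'' htwA hgo
    rw [h0, padicValNat.eq_zero_iff] at hG1'
    rcases hG1' with h1 | h1 | h1
    · exact absurd h1 hp.one_lt.ne'
    · exact absurd h1 (A.tamagawaProduct_pos_holds).ne'
    · exact h1
  exact ThreeFieldRowClosed.jointUpperBoundAt_genus hmod hGZK f6 hGZ73 f10 fMaz hG1 hNek hP53 Wd A p K'' h5 hrd hrA hcell hsurj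
    hK'' hfree htwA hgo htamd htamA

/-- **k = 1, CLOSED IN-FILE from S2–S6**: the J-adapter supplies the stringent genus datum at the offending prime `r`, the GLOBAL statement makes it
sharp at depth `e = ord_p ∏c(Wd)`, the PROVED sharp machine gives `ord_p #Ш(Wd/K″)[p^∞] + 2e ≤ 2·ord_p [Wd(K″) : ℤPt]`, the PROVED splitting
`#Ш(Wd/K″)[p^∞] = p^{ord_p #Ш(Wd) + ord_p #Ш(A)}` and G1 + G2 turn it into `JointUpperBoundAt Wd A p`. -/
theorem jointUpperBoundAt_kOne (hPF : ThreeFieldRoad.PrintedFactsR0) (hPT : PoitouTatePrint) (hE0 : PerPlaceE0GZ)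
    (hSup : ThreeFieldRoad.PrintedFactsR0 → PerPlaceE0GZ → GenusStringentSupplyK1)
    (hSTS : PoitouTatePrint → StringentToSharp) (hPar : TamagawaParityR0)
    (Wd : WeierstrassCurve ℚ) [Wd.IsElliptic] [Wd.IsGloballyMinimal]
    (A : WeierstrassCurve ℚ) [A.IsElliptic] [A.IsGloballyMinimal] (p : ℕ) [Fact p.Prime]
    (K'' : Type) [Field K''] [NumberField K'']
    (h5 : 5 ≤ p) (hrd : Wd.analyticRank = 1) (hrA : A.analyticRank = 0) (hcell : N10.CellGordTwo Wd p) (hsurj : Surj Wd p)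
    (hK'' : RamifiedKolyvaginField Wd A p K'')
    (hfree : ∃ ℓ : ℕ, ℓ.Prime ∧ (ℓ : ℤ) ∣ NumberField.discr K'' ∧ ℓ ≠ p ∧ ¬ ℓ ∣ Wd.conductorNorm ℤ)
    (htwA : ∃ C : WeierstrassCurve.VariableChange ℚ, C • Wd.quadraticTwist (NumberField.discr K'' : ℚ) = A)
    (hgo : GoodOrd A p) (hk : p ∣ Wd.tamagawaProduct) (huniq : AtMostOneTamagawaPlace Wd p) :
    SchneiderFree.Upper.JointUpperBoundAt Wd A p := by
  have hp : p.Prime := Fact.out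
  have hp2 : p ≠ 2 := by omega
  haveI : NeZero (Wd.conductorNorm ℤ) := ⟨(WeierstrassCurve.conductorNorm_pos_holds Wd).ne'⟩
  haveI hWdK : (Wd.baseChange K'').IsElliptic := inferInstanceAs (Wd.map (algebraMap ℚ K'')).IsElliptic
  -- «GZK» over `ℚ` from print: `Ш(Wd)`, `Ш(A)` finite
  obtain ⟨fB, fK, f6, -, f10, -, -, -, f16, -, -, -, -, -, -, -, -, -, -, -⟩ := id hPF
  have hGZK : rank_eq_analyticRank_of_analyticRank_le_one :=
    ExplicitGrossZagierTrivialChar.rank_eq_analyticRank_of_analyticRank_le_one_of_kolyvagin f6 f16 fB f10 fK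
  obtain ⟨-, hfinWd⟩ := hGZK Wd hrd.le
  obtain ⟨-, hfinA⟩ := hGZK A (hrA.trans_le zero_le_one)
  haveI := hfinWd
  haveI := hfinA
  -- the PROVED splitting of the `p`-primary part over `K″`
  have hsplit := Wd.card_primaryComponent_sha_baseChange_quadratic_of_odd_of_finite K'' hK''.1.1 A htwA (Wd.baseChange K'')
    ⟨1, one_smul _ _⟩ p hp2
  have hWd' : Nat.card (AddCommGroup.primaryComponent Wd.sha p) = p ^ padicValNat p Wd.shaOrder :=
    natCard_primaryComponent_eq_pow_padicValNat (A := Wd.sha) p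
  have hA' : Nat.card (AddCommGroup.primaryComponent A.sha p) = p ^ padicValNat p A.shaOrder :=
    natCard_primaryComponent_eq_pow_padicValNat (A := A.sha) p
  rw [hWd', hA', ← pow_add] at hsplit
  -- S4: the stringent genus datum at the offending prime `r`, with G2
  obtain ⟨ιc, r, hr, Pt, n', hnt, hidx, hr2, hre, hn', ⟨q, qA, hq, hqA, hG2⟩, hLoff, hdat⟩ :=
    hSup hPF hE0 Wd A p K'' h5 hrd hrA hcell hsurj hK'' hfree htwA hgo hk huniq
  -- S5 (GLOBAL): stringent ⟹ sharp at depth `e = ord_p ∏c(Wd)`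
  have hsharp : SharpPointDatum Wd K'' p Pt (padicValNat p Wd.tamagawaProduct) :=
    hSTS hPT Wd K'' ιc p r (padicValNat p Wd.tamagawaProduct) Pt n' hK''.1 h5 hsurj hnt hidx hr hr2 hre hn' hLoff hdat
  -- the PROVED sharp machine
  have hM := (padicValNat_card_sha_primaryComponent_add_le_of_sharpPoints Wd hK''.1 rfl hnt hp hp2 hsurj hidx
    (padicValNat p Wd.tamagawaProduct) hsharp).2
  rw [hsplit, padicValNat.prime_pow] at hM
  -- G1 and the arithmetic
  have hG1 := hPar Wd A p K'' h5 hcell hK'' htwA hgo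
  rw [hG1] at hG2
  refine ⟨q, qA, hq, hqA, ?_⟩
  have hM' : (padicValNat p Wd.shaOrder : ℤ) + (padicValNat p A.shaOrder : ℤ) + 2 * (padicValNat p Wd.tamagawaProduct : ℤ) ≤
      2 * (padicValNat p (AddSubgroup.zmultiples Pt).index : ℤ) := by exact_mod_cast hM
  linarith

/-- **J from the stubs, by the k-trichotomy** (k ≥ 2: S7; k ≤ 1 and `p ∣ ∏c(Wd)`: `jointUpperBoundAt_kOne`; `p ∤ ∏c(Wd)`: `jointUpperBoundAt_kZero`). -/
theorem genusJointUpperTamFreeR0_of_stubs (hPF : PrintedFactsK1) (hE0 : PerPlaceE0GZ)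
    (hSup : ThreeFieldRoad.PrintedFactsR0 → PerPlaceE0GZ → GenusStringentSupplyK1)
    (hSTS : PoitouTatePrint → StringentToSharp) (hPar : TamagawaParityR0)
    (hK2 : ThreeFieldRoad.PrintedFactsR0 → GenusJointUpperKTwoR0) :
    ThreeFieldRoad.GenusJointUpperTamFreeR0 := by
  intro Wd _ _ A _ _ p _ K'' _ _ h5 hrd hrA hcell hsurj hK'' hfree htwA hgo
  by_cases h2 : TwoTamagawaPlaces Wd p
  · exact hK2 hPF.1 Wd A p K'' h5 hrd hrA hcell hsurj hK'' hfree htwA hgo h2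
  have huniq : AtMostOneTamagawaPlace Wd p := by
    intro v₀ v₁ h₀ h₁
    by_contra hne
    exact h2 ⟨v₀, v₁, hne, h₀, h₁⟩
  by_cases hk : p ∣ Wd.tamagawaProduct
  · exact jointUpperBoundAt_kOne hPF.1 hPF.2 hE0 hSup hSTS hPar Wd A p K'' h5 hrd hrA hcell hsurj hK'' hfree htwA hgo hk huniq
  · exact jointUpperBoundAt_kZero hPF.1 hPar Wd A p K'' h5 hrd hrA hcell hsurj hK'' hfree htwA hgo hk

/-! ## §3 The composition (kernel-checked; concludes the crux BY NAME) -/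

/-! ### Name-keyed aliases of the seven stub statements — the hypotheses of the skeleton theorem
The native skeleton audit (`ledger skeleton check`) admits a hypothesis of the skeleton theorem only if its head constant is a
registered obligation or is NAMED like a declared stub (`skeleton.extra-hypothesis` otherwise); `__Registered.stub_X` is the
statement of `theorem stub_X` under that short name (device of `HodgeConjecture/…/Cruxes/HodgeAbelianDimGeEight/Lines/birth.lean`;
the `__` namespace is an implementation detail). Each alias is an `abbrev`, definitionally the stub's statement. -/
namespace __Registered

/-- Alias of `ResidualR0` (statement of `stub_residualR0`). -/
abbrev stub_residualR0 : Prop := ResidualR0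
/-- Alias of `PrintedFactsK1` (statement of `stub_printedFactsK1`). [v3] -/
abbrev stub_printedFactsK1 : Prop := PrintedFactsK1
/-- Alias of `PerPlaceE0GZ` (statement of `stub_perPlaceE0GZ`). -/
abbrev stub_perPlaceE0GZ : Prop := PerPlaceE0GZ
/-- Alias of the statement of `stub_genusStringentSupplyK1`. -/
abbrev stub_genusStringentSupplyK1 : Prop := ThreeFieldRoad.PrintedFactsR0 → PerPlaceE0GZ → GenusStringentSupplyK1
/-- Alias of the statement of `stub_stringentToSharp` (`PoitouTatePrint → StringentToSharp`). [v3] -/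
abbrev stub_stringentToSharp : Prop := PoitouTatePrint → StringentToSharp
/-- Alias of `TamagawaParityR0` (statement of `stub_tamagawaParityR0`). -/
abbrev stub_tamagawaParityR0 : Prop := TamagawaParityR0
/-- Alias of the statement of `stub_residualKTwo`. -/
abbrev stub_residualKTwo : Prop := ThreeFieldRoad.PrintedFactsR0 → GenusJointUpperKTwoR0

end __Registered

/-- **THE SKELETON THEOREM**: the crux `GordTwoRankZeroOffCaseOne` BY NAME from exactly the seven stub STATEMENTS (name-keyed aliases;
no `stub_*` theorem is used, no sorry of its own): v48's eight-door case split (`ThreeFieldRoad.*_closed` ∕ `*T_closed`, all sorry-free),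
with v48's J supplied by `genusJointUpperTamFreeR0_of_stubs` (k = 0 and k = 1 proved in §2, k ≥ 2 the declared residual). -/
theorem GordTwoRankZeroOffCaseOne_of :
    __Registered.stub_residualR0 → __Registered.stub_printedFactsK1 → __Registered.stub_perPlaceE0GZ →
      __Registered.stub_genusStringentSupplyK1 → __Registered.stub_stringentToSharp → __Registered.stub_tamagawaParityR0 →
        __Registered.stub_residualKTwo → GordTwoRankZeroOffCaseOne := by
  intro hRes hPF' hE0 hSup hSTS hPar hK2 W _ _ p _ hr hcell hc1
  have hJ : ThreeFieldRoad.GenusJointUpperTamFreeR0 := genusJointUpperTamFreeR0_of_stubs hPF' hE0 hSup hSTS hPar hK2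
  have hPF : ThreeFieldRoad.PrintedFactsR0 := hPF'.1
  by_cases hs : ThreeFieldRoad.TwistRow W p
  · exact ThreeFieldRoad.twistRow_closed hPF W p hr hcell hs
  by_cases h2 : ThreeFieldRoad.DyadicWanRowR0 W p
  · exact ThreeFieldRoad.dyadicWanRowR0_closed hPF W p hr hcell h2
  by_cases h3 : ThreeFieldRoad.TwistedWanRowR0LooseUnitCut W p
  · exact ThreeFieldRoad.twistedWanChainR0Loose_closed hPF W p hr hcell h3
  by_cases h4 : ThreeFieldRoad.TwistedWanRowR0Two W p
  · exact ThreeFieldRoad.twistedWanChainR0Two_closed hPF W p hr hcell h4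
  by_cases h5 : ThreeFieldRoad.TwistRowT W p
  · exact ThreeFieldRoad.twistRowT_closed hPF hJ W p hr hcell h5
  by_cases h6 : ThreeFieldRoad.DyadicWanRowR0T W p
  · exact ThreeFieldRoad.dyadicWanRowR0T_closed hPF hJ W p hr hcell h6
  by_cases h7 : ThreeFieldRoad.TwistedWanRowR0LooseUnitCutT W p
  · exact ThreeFieldRoad.twistedWanChainR0LooseT_closed hPF hJ W p hr hcell h7
  by_cases h8 : ThreeFieldRoad.TwistedWanRowR0TwoT W p
  · exact ThreeFieldRoad.twistedWanChainR0TwoT_closed hPF hJ W p hr hcell h8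
  · exact hRes W p hr hcell hc1 h5 h6 h7 h8

/-- **The crux from its registered stubs**: `GordTwoRankZeroOffCaseOne` BY NAME with the seven sorried `stub_*` theorems plugged into
`GordTwoRankZeroOffCaseOne_of` (conditional on them; no sorry of its own). -/
theorem GordTwoRankZeroOffCaseOne_of_stubs : GordTwoRankZeroOffCaseOne :=
  GordTwoRankZeroOffCaseOne_of stub_residualR0 stub_printedFactsK1 stub_perPlaceE0GZ stub_genusStringentSupplyK1
    stub_stringentToSharp stub_tamagawaParityR0 stub_residualKTwo

end Summit.BirchSwinnertonDyer.BirchSwinnertonDyer.Cruxes.GordTwoRankZeroOffCaseOne.GenusStringentRoadK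

end
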